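import Literature.MathematicalPhysics.QuantumFieldTheory.Balaban1983to89.T3PrintedRegularMinimiserReduction
import Literature.MathematicalPhysics.QuantumFieldTheory.Balaban1983to89.T3UnitLawGaugeInvariance
import HarnessLib

/-!
# `Balaban1983to89.T3PrintedRegularOrbits` — rung R3, crux K1: [Balaban1985Variational] p. 278 «The space 𝔘_k({Ω_j}, ε₀) is gauge
# invariant, and the space 𝔅_k(𝔅_k, V) is invariant with respect to gauge transformations u satisfying u(y) = 1 for y ∈ 𝔅_k (4) …
# the space (6) is a union of orbits of this group» WITH BODY for the d = 3 family, and the GAUGE INVARIANCE OF THE THREE BACKGROUND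
# FUNCTIONALS `minAction`, `minActionReg`, `minActionRegPr` as functions of the datum `V`

Cell `ym3-torus` (HUMAN RULING D-0037, YM ladder rung R3), seat `ym3-torus-p1` gen 5 (cell record HOME/UV3-NODE.md §12).  WHAT THIS IS NOT:
no estimate; structural facts (kernel-checked, no hypotheses beyond the standing range) about the objects of `T3ConstrainedMinimiser`
(p408691), `T3RegularMinimiser` (p411848) and `T3PrintedRegularMinimiser` (p415317).

* §1 `descTransf` — a gauge transformation of run `K`'s finest lattice RESTRICTED to the comparison lattice of height `n` (block centres,
  `T4Continuum.transfUp` read through `T3LevelShift.siteShift`) — and **`descendTo_gaugeAct`**: `D_{n,K}(U^u) = (D_{n,K}U)^{u↓}`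
  ([Balaban1985Averaging] (11) «Ū^u = (Ū)^u», iterated: `T4Continuum.iter_gaugeAct` + `fieldShift_gaugeAct`); **`liftTransfTo`**: every
  gauge transformation `w` of the comparison lattice IS `u↓` for the lift `u(z) = w(block^{K−n} z)` (`transfUp_blockUp`).
* §2 [7] p. 278 with body: the printed regularity `RegPr` (both clauses of (2)) is gauge invariant (`regPr_gaugeAct_iff`, through the
  dictionary `regPr_iff_inSpace` and the LQB lane's `inSpace_gaugeAct_iff`); the fibre, the plaquette-only regular fibre and print's regular
  fibre (6) are mapped onto the fibres of `V^{u↓}` (`gaugeAct_mem_fibre_iff`, `…regFibre_iff`, `…regFibrePr_iff`); in particular they are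
  INVARIANT under the group (4) `{u : u↓ = 1}` — «(6) is a union of orbits of this group».
* §3 **THE BACKGROUND FUNCTIONALS ARE GAUGE INVARIANT FUNCTIONS OF THE DATUM**: `minAction (V^w) = minAction V`, `minActionReg (V^w) =
  minActionReg V`, `minActionRegPr (V^w) = minActionRegPr V` for EVERY gauge transformation `w` of the comparison lattice (lift `w`, move the
  fibre, `A(U^u) = A(U)`), and a minimiser over (6) stays a minimiser along its orbit (`isMin_regFibrePr_gaugeAct`) — the «minimal ORBIT» of
  Thm 1 p. 279.

References: T. Bałaban, CMP 102 (1985) 277–309 [Balaban1985Variational] ((4), (6) p.278, Thm 1 p.279); CMP 98 (1985) 17–51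
[Balaban1985Averaging] ((11)–(13) p.19).
-/

noncomputable section

open MeasureTheory Filter Topology
open scoped Matrix.Norms.L2Operator
open Literature.MathematicalPhysics.QuantumFieldTheory.Balaban1983to89.T3ContinuumYM3Torus
open Literature.MathematicalPhysics.QuantumFieldTheory.Balaban1983to89.T3LevelShift
open Literature.MathematicalPhysics.QuantumFieldTheory.Balaban1983to89.T3UnitLawDensityEML (ℰp measurableE_ℰp)
open Literature.MathematicalPhysics.QuantumFieldTheory.Balaban1983to89.T3UnitScaleTilt
open Literature.MathematicalPhysics.QuantumFieldTheory.Balaban1983to89.T3TiltDescent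
open Literature.MathematicalPhysics.QuantumFieldTheory.Balaban1983to89.T3ConstrainedMinimiser
open Literature.MathematicalPhysics.QuantumFieldTheory.Balaban1983to89.T3RegularMinimiser
open Literature.MathematicalPhysics.QuantumFieldTheory.Balaban1983to89.T3PrintedRegularMinimiser
open Literature.MathematicalPhysics.QuantumFieldTheory.Balaban1983to89.T3UnitLawGaugeInvariance
open Literature.MathematicalPhysics.QuantumFieldTheory.Balaban1983to89.T4Continuum
open Literature.MathematicalPhysics.QuantumFieldTheory.Balaban1983to89.B10Eq27TorusAxialLog (toUField suIncl)
open Literature.MathematicalPhysics.QuantumFieldTheory.Balaban1983to89.B10Eq68TorusRegularity (inSpace_gaugeAct_iff)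
open Literature.MathematicalPhysics.QuantumFieldTheory.Balaban1983to89.Missing

namespace Literature.MathematicalPhysics.QuantumFieldTheory.Balaban1983to89.T3PrintedRegularOrbits

/-! ## §1 Gauge transformations descend along `D_{n,K}`, and every coarse one lifts -/

section Descend

variable (F : T3Family) {G : Type*} [GaugeGroup G] (ℰ : LoopAverage G) (n K : ℕ)

/-- The propositional identification of the height-`(K−n)` lattice of run `K` with the finest lattice of run `n` (the `h` of
`T3TiltDescent.descendTo`). [cite: Balaban1987RG1, (0.11) p.253] -/
theorem sites_eq (h : n ≤ K) : (F.PP F.m n).sitesPerDir 0 = (F.PP F.m K).sitesPerDir (K - n) :=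
  F.sitesPerDir_eq (m := F.m) (K := n) (j := 0) (m' := F.m) (K' := K) (j' := K - n) (by omega)

/-- **A gauge transformation of run `K`'s finest lattice RESTRICTED TO THE COMPARISON LATTICE of height `n`**: `u↓(x) = u^{(K−n)}(x)`
(restriction up the block centres, `transfUp`, read through `siteShift`). [cite: Balaban1985Averaging, (12)-(13) p.19] -/
def descTransf (h : n ≤ K) (u : GaugeTransf (F.P K) 0 G) : GaugeTransf (F.P n) 0 G :=
  fun x => transfUp u (K - n) (siteShift (sites_eq F n K h) x)

/-- **`D_{n,K}(U^u) = (D_{n,K}U)^{u↓}`** — covariance of the descent ([Balaban1985Averaging] (11), iterated `K − n` times in the standing range,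
then read on the `n`-th tower). [cite: Balaban1985Averaging, (11) p.19] -/
theorem descendTo_gaugeAct (h : n ≤ K) (u : GaugeTransf (F.P K) 0 G) (U : GaugeField (F.P K) 0 G) :
    descendTo F ℰ n K h (GaugeField.gaugeAct u U) = GaugeField.gaugeAct (descTransf F n K h u) (descendTo F ℰ n K h U) := by
  unfold descendTo descTransf
  rw [iter_gaugeAct (fun i => BlockAveraging.blockAvg (P := F.P K) (j := i) ℰ) u (K - n) (by show K - n ≤ F.m + K; omega) U]
  exact fieldShift_gaugeAct _ _ _

/-- **EVERY GAUGE TRANSFORMATION OF THE COMPARISON LATTICE LIFTS**: `u(z) := w(block^{K−n} z)` (read through `siteShift`) has `u↓ = w`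
([Balaban1985Averaging] (12)–(13) «u coinciding with v at points of the new lattice»). [cite: Balaban1985Averaging, (12) p.19] -/
def liftTransfTo (h : n ≤ K) (w : GaugeTransf (F.P n) 0 G) : GaugeTransf (F.P K) 0 G :=
  fun z => w ((siteShift (sites_eq F n K h)).symm (blockUp (K - n) z))

omit [GaugeGroup G] in
/-- `(liftTransfTo w)↓ = w`. [cite: Balaban1985Averaging, (12) p.19] -/
theorem descTransf_liftTransfTo (h : n ≤ K) (w : GaugeTransf (F.P n) 0 G) :
    descTransf F n K h (liftTransfTo F n K h w) = w := by
  funext x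
  unfold descTransf liftTransfTo
  have hk : K - n ≤ (F.P K).m + (F.P K).K := by show K - n ≤ F.m + K; omega
  have h1 := congrFun (transfUp_blockUp (P := F.P K) (K - n) hk (fun y => w ((siteShift (sites_eq F n K h)).symm y)))
    (siteShift (sites_eq F n K h) x)
  exact h1.trans (congrArg w (Equiv.symm_apply_apply _ x))

end Descend

/-! ## §2 [7] p. 278 with body: the regular space is gauge invariant, the fibres are permuted, the group (4) preserves (6) -/

section Invariance

variable (F : T3Family) {n K : ℕ} (h : n ≤ K) {ε₀ : ℝ}

/-- The trivial gauge transformation acts trivially (local helper). [folklore] -/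
private theorem gaugeAct_one' {P : Params} {j : ℕ} {G : Type*} [GaugeGroup G] (U : GaugeField P j G) :
    GaugeField.gaugeAct (fun _ => (1 : G)) U = U := by
  funext b; simp [GaugeField.gaugeAct]

/-- `SU(2) ≤ U(2)` commutes with gauge transformations (`suIncl` is a homomorphism). [cite: Balaban1985Averaging, (8) p.19] -/
theorem toUField_gaugeAct {P : Params} {j N : ℕ} [NeZero N] (u : GaugeTransf P j (Matrix.specialUnitaryGroup (Fin N) ℂ))
    (U : GaugeField P j (Matrix.specialUnitaryGroup (Fin N) ℂ)) :
    toUField (GaugeField.gaugeAct u U) = GaugeField.gaugeAct (fun x => suIncl (u x)) (toUField U) := by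
  funext b
  simp [toUField, GaugeField.gaugeAct, map_mul, map_inv]

/-- **[7] p. 278 «The space 𝔘_k({Ω_j}, ε₀) is gauge invariant»** for the family's printed regularity (both clauses of (2); `ε₀ ≥ 0`;
through the dictionary `regPr_iff_inSpace` and the LQB lane's `inSpace_gaugeAct_iff`). [cite: Balaban1985Variational, p.278 (sentence after (3))] -/
theorem regPr_gaugeAct_iff (hε : 0 ≤ ε₀) (u : GaugeTransf (F.P K) 0 (Matrix.specialUnitaryGroup (Fin 2) ℂ))
    (U : GaugeField (F.P K) 0 (Matrix.specialUnitaryGroup (Fin 2) ℂ)) :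
    RegPr F n K ε₀ (GaugeField.gaugeAct u U) ↔ RegPr F n K ε₀ U := by
  rw [regPr_iff_inSpace hε, regPr_iff_inSpace hε, toUField_gaugeAct]
  exact inSpace_gaugeAct_iff _ _

/-- The plaquette-only regularity is gauge invariant for every threshold (`dist1 (gWg⁻¹) = dist1 W`). [cite: Balaban1985Variational, p.278 (sentence after (3))] -/
theorem plaqSmall_gaugeAct_iff' {P : Params} {j : ℕ} {G : Type*} [GaugeGroup G] (δ : ℝ) (u : GaugeTransf P j G)
    (U : GaugeField P j G) : PlaqSmall δ (GaugeField.gaugeAct u U) ↔ PlaqSmall δ U := by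
  simp only [PlaqSmall, T4WilsonGaugeFlatDirection.plaqHol_gaugeAct, GaugeGroup.dist1_conj]

variable {G : Type*} [GaugeGroup G] (ℰ : LoopAverage G)

/-- **THE FIBRES ARE PERMUTED**: `U^u ∈ fibre(V^{u↓}) ↔ U ∈ fibre(V)` (covariance of the descent; gauge transformations act bijectively).
[cite: Balaban1985Variational, (3)-(4) p.278] -/
theorem gaugeAct_mem_fibre_iff (u : GaugeTransf (F.P K) 0 G) (U : GaugeField (F.P K) 0 G) (V : GaugeField (F.P n) 0 G) :
    GaugeField.gaugeAct u U ∈ fibre F ℰ n K h (GaugeField.gaugeAct (descTransf F n K h u) V) ↔ U ∈ fibre F ℰ n K h V := by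
  show descendTo F ℰ n K h (GaugeField.gaugeAct u U) = _ ↔ descendTo F ℰ n K h U = V
  rw [descendTo_gaugeAct]
  constructor
  · intro hU
    have := congrArg (GaugeField.gaugeAct (fun x => (descTransf F n K h u x)⁻¹)) hU
    simpa [gaugeAct_gaugeAct, gaugeAct_one'] using this
  · intro hU; rw [hU]

/-- **[7] (4): the fibre is INVARIANT under gauge transformations trivial on the comparison lattice** («the space 𝔅_k(𝔅_k, V) is invariant
with respect to gauge transformations u satisfying u(y) = 1 for y ∈ 𝔅_k»). [cite: Balaban1985Variational, (4) p.278] -/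
theorem gaugeAct_mem_fibre_iff_of_trivial {u : GaugeTransf (F.P K) 0 G} (hu : descTransf F n K h u = fun _ => 1)
    (U : GaugeField (F.P K) 0 G) (V : GaugeField (F.P n) 0 G) :
    GaugeField.gaugeAct u U ∈ fibre F ℰ n K h V ↔ U ∈ fibre F ℰ n K h V := by
  have h1 := gaugeAct_mem_fibre_iff F h ℰ u U V
  rwa [hu, gaugeAct_one'] at h1

/-- The plaquette-only regular fibres are permuted likewise. [cite: Balaban1985Variational, (6) p.278] -/
theorem gaugeAct_mem_regFibre_iff (u : GaugeTransf (F.P K) 0 G) (U : GaugeField (F.P K) 0 G) (V : GaugeField (F.P n) 0 G) :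
    GaugeField.gaugeAct u U ∈ regFibre F ℰ n K h ε₀ (GaugeField.gaugeAct (descTransf F n K h u) V) ↔ U ∈ regFibre F ℰ n K h ε₀ V := by
  show _ ∈ fibre F ℰ n K h _ ∩ _ ↔ _ ∈ fibre F ℰ n K h V ∩ _
  rw [Set.mem_inter_iff, Set.mem_inter_iff, gaugeAct_mem_fibre_iff]
  exact and_congr Iff.rfl (plaqSmall_gaugeAct_iff' _ u U)

/-- **PRINT'S REGULAR FIBRES (6) ARE PERMUTED**: `U^u ∈ (6)(V^{u↓}) ↔ U ∈ (6)(V)` (`SU(2)`, the family's `ℰp`, `ε₀ ≥ 0`).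
[cite: Balaban1985Variational, (6) p.278] -/
theorem gaugeAct_mem_regFibrePr_iff (hε : 0 ≤ ε₀) (u : GaugeTransf (F.P K) 0 (Matrix.specialUnitaryGroup (Fin 2) ℂ))
    (U : GaugeField (F.P K) 0 (Matrix.specialUnitaryGroup (Fin 2) ℂ)) (V : GaugeField (F.P n) 0 (Matrix.specialUnitaryGroup (Fin 2) ℂ)) :
    GaugeField.gaugeAct u U ∈ regFibrePr F n K h ε₀ (GaugeField.gaugeAct (descTransf F n K h u) V) ↔ U ∈ regFibrePr F n K h ε₀ V := by
  rw [mem_regFibrePr_iff, mem_regFibrePr_iff, gaugeAct_mem_fibre_iff, regPr_gaugeAct_iff F hε]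

/-- **[7] p. 278 «the space (6) is a union of orbits of this group»**: (6) is invariant under every `u` with `u↓ = 1` (`ε₀ ≥ 0`).
[cite: Balaban1985Variational, (6) p.278] -/
theorem gaugeAct_mem_regFibrePr_iff_of_trivial (hε : 0 ≤ ε₀) {u : GaugeTransf (F.P K) 0 (Matrix.specialUnitaryGroup (Fin 2) ℂ)}
    (hu : descTransf F n K h u = fun _ => 1) (U : GaugeField (F.P K) 0 (Matrix.specialUnitaryGroup (Fin 2) ℂ))
    (V : GaugeField (F.P n) 0 (Matrix.specialUnitaryGroup (Fin 2) ℂ)) :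
    GaugeField.gaugeAct u U ∈ regFibrePr F n K h ε₀ V ↔ U ∈ regFibrePr F n K h ε₀ V := by
  have h1 := gaugeAct_mem_regFibrePr_iff F h hε u U V
  rwa [hu, gaugeAct_one'] at h1

end Invariance

/-! ## §3 The background functionals are gauge invariant functions of the datum; minimisers go along orbits -/

section Functionals

variable (F : T3Family) {n K : ℕ} (h : n ≤ K) {ε₀ : ℝ}

/-- `A(U^u) = A(U)` for the unit-weight Wilson action (the tree's `wilsonAction_gaugeAct` at weight `1`; local restatement, the tree's copies
are private). [folklore] -/
private theorem wilsonAction4_gaugeAct'' {P : Params} {j : ℕ} {G : Type*} [GaugeGroup G] (u : GaugeTransf P j G) (U : GaugeField P j G) :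
    wilsonAction4 (GaugeField.gaugeAct u U) = wilsonAction4 U :=
  T4WilsonGaugeFlatDirection.wilsonAction_gaugeAct 1 u U

/-- Images of a set of configurations under a gauge transformation have the same action values (`A(U^u) = A(U)`), hence the same
infimum (local helper: if `u` maps `S` into `T` and `u⁻¹` maps `T` into `S`, the two `sInf`s agree). [folklore] -/
private theorem sInf_image_eq_of_gaugeAct {P : Params} {j : ℕ} {G : Type*} [GaugeGroup G] (u : GaugeTransf P j G)
    {S T : Set (GaugeField P j G)} (hST : ∀ U ∈ S, GaugeField.gaugeAct u U ∈ T)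
    (hTS : ∀ W ∈ T, GaugeField.gaugeAct (fun x => (u x)⁻¹) W ∈ S) :
    sInf ((fun U => wilsonAction4 U) '' S) = sInf ((fun U => wilsonAction4 U) '' T) := by
  congr 1
  ext a
  constructor
  · rintro ⟨U, hU, rfl⟩
    exact ⟨_, hST U hU, wilsonAction4_gaugeAct'' u U⟩
  · rintro ⟨W, hW, rfl⟩
    exact ⟨_, hTS W hW, wilsonAction4_gaugeAct'' _ W⟩

/-- The restriction of the inverse transformation is the inverse of the restriction (local helper). [folklore] -/
private theorem descTransf_inv {G : Type*} [GaugeGroup G] (u : GaugeTransf (F.P K) 0 G) :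
    descTransf F n K h (fun x => (u x)⁻¹) = fun x => (descTransf F n K h u x)⁻¹ := by
  funext x
  unfold descTransf
  suffices hk : ∀ (k : ℕ) (y : Site (F.P K) k), transfUp (fun x => (u x)⁻¹) k y = (transfUp u k y)⁻¹ from hk _ _
  intro k
  induction k with
  | zero => intro y; rfl
  | succ k ih => intro y; exact ih (emb y)

variable {G : Type*} [GaugeGroup G] (ℰ : LoopAverage G)

/-- **`minAction` IS A GAUGE INVARIANT FUNCTION OF THE DATUM**: `minAction (V^w) = minAction V` for every gauge transformation `w` of the
comparison lattice (lift `w`; the lift maps `fibre V` onto `fibre V^w`; `A` is invariant). [cite: Balaban1985Variational, Thm 1 p.279] -/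
theorem minAction_gaugeAct (w : GaugeTransf (F.P n) 0 G) (V : GaugeField (F.P n) 0 G) :
    minAction F ℰ n K h (GaugeField.gaugeAct w V) = minAction F ℰ n K h V := by
  have hw := descTransf_liftTransfTo F n K h w
  refine (sInf_image_eq_of_gaugeAct (liftTransfTo F n K h w) (fun U hU => ?_) (fun W hW => ?_)).symm
  · have h1 := (gaugeAct_mem_fibre_iff F h ℰ (liftTransfTo F n K h w) U V).mpr hU
    rwa [hw] at h1
  · have h1 := (gaugeAct_mem_fibre_iff F h ℰ (fun x => (liftTransfTo F n K h w x)⁻¹) W (GaugeField.gaugeAct w V)).mpr hW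
    rwa [descTransf_inv, hw, gaugeAct_gaugeAct, show (fun x => (w x)⁻¹ * w x) = fun _ => (1 : G) from funext fun x => inv_mul_cancel _,
      gaugeAct_one'] at h1

/-- **`minActionReg` IS A GAUGE INVARIANT FUNCTION OF THE DATUM** (every threshold `ε₀`). [cite: Balaban1985Variational, Thm 1 p.279] -/
theorem minActionReg_gaugeAct (w : GaugeTransf (F.P n) 0 G) (V : GaugeField (F.P n) 0 G) :
    minActionReg F ℰ n K h ε₀ (GaugeField.gaugeAct w V) = minActionReg F ℰ n K h ε₀ V := by
  have hw := descTransf_liftTransfTo F n K h w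
  refine (sInf_image_eq_of_gaugeAct (liftTransfTo F n K h w) (fun U hU => ?_) (fun W hW => ?_)).symm
  · have h1 := (gaugeAct_mem_regFibre_iff F h ℰ (ε₀ := ε₀) (liftTransfTo F n K h w) U V).mpr hU
    rwa [hw] at h1
  · have h1 := (gaugeAct_mem_regFibre_iff F h ℰ (ε₀ := ε₀) (fun x => (liftTransfTo F n K h w x)⁻¹) W (GaugeField.gaugeAct w V)).mpr hW
    rwa [descTransf_inv, hw, gaugeAct_gaugeAct, show (fun x => (w x)⁻¹ * w x) = fun _ => (1 : G) from funext fun x => inv_mul_cancel _,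
      gaugeAct_one'] at h1

/-- **`minActionRegPr` IS A GAUGE INVARIANT FUNCTION OF THE DATUM** (`SU(2)`, `ℰp`, `ε₀ ≥ 0`): the action of Bałaban's background
field `U_k(V)` depends on the orbit of `V` only. [cite: Balaban1985Variational, Thm 1 p.279] -/
theorem minActionRegPr_gaugeAct (hε : 0 ≤ ε₀) (w : GaugeTransf (F.P n) 0 (Matrix.specialUnitaryGroup (Fin 2) ℂ))
    (V : GaugeField (F.P n) 0 (Matrix.specialUnitaryGroup (Fin 2) ℂ)) :
    minActionRegPr F n K h ε₀ (GaugeField.gaugeAct w V) = minActionRegPr F n K h ε₀ V := by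
  have hw := descTransf_liftTransfTo F n K h w
  refine (sInf_image_eq_of_gaugeAct (liftTransfTo F n K h w) (fun U hU => ?_) (fun W hW => ?_)).symm
  · have h1 := (gaugeAct_mem_regFibrePr_iff F h hε (liftTransfTo F n K h w) U V).mpr hU
    rwa [hw] at h1
  · have h1 := (gaugeAct_mem_regFibrePr_iff F h hε (fun x => (liftTransfTo F n K h w x)⁻¹) W (GaugeField.gaugeAct w V)).mpr hW
    rwa [descTransf_inv, hw, gaugeAct_gaugeAct, show (fun x => (w x)⁻¹ * w x) = fun _ => (1 : Matrix.specialUnitaryGroup (Fin 2) ℂ)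
      from funext fun x => inv_mul_cancel _, gaugeAct_one'] at h1

/-- **«MINIMAL ORBIT»** ([7] Thm 1 p. 279): if `U` minimises the Wilson action over print's regular fibre (6) of `V`, then so does every
`U^u` with `u↓ = 1` (the group (4)); `ε₀ ≥ 0`. [cite: Balaban1985Variational, Thm 1 (8) p.279] -/
theorem isMin_regFibrePr_gaugeAct (hε : 0 ≤ ε₀) {u : GaugeTransf (F.P K) 0 (Matrix.specialUnitaryGroup (Fin 2) ℂ)}
    (hu : descTransf F n K h u = fun _ => 1) {V : GaugeField (F.P n) 0 (Matrix.specialUnitaryGroup (Fin 2) ℂ)}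
    {U : GaugeField (F.P K) 0 (Matrix.specialUnitaryGroup (Fin 2) ℂ)} (hU : U ∈ regFibrePr F n K h ε₀ V)
    (hmin : wilsonAction4 U = minActionRegPr F n K h ε₀ V) :
    GaugeField.gaugeAct u U ∈ regFibrePr F n K h ε₀ V ∧ wilsonAction4 (GaugeField.gaugeAct u U) = minActionRegPr F n K h ε₀ V :=
  ⟨(gaugeAct_mem_regFibrePr_iff_of_trivial F h hε hu U V).mpr hU,
    by rw [wilsonAction4_gaugeAct'']; exact hmin⟩

end Functionals

end Literature.MathematicalPhysics.QuantumFieldTheory.Balaban1983to89.T3PrintedRegularOrbits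

end
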